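import Summits.NavierStokesRegularity.NavierStokesRegularity.Theorems.PeepholeVorticityDoorDefs
import Summits.NavierStokesRegularity.NavierStokesRegularity.Theorems.StableStrataDoorClassSlabLevels
import Literature.Analysis.FluidPDE.ClassicalSolutionRegionRescale
import Literature.Analysis.FluidPDE.FlatSwirlGauge

/-!
# PeepholeVorticityDoorFrameTools — door S29 «PeepholeVorticityDoor», FILE 4b-tools of the LINE DOC: the parabolic change of
# frame between the Leray–Hopf door frame and the Pineau–Vicol frame (nsreg-p6 g15, DIRECTOR-NS #106 (1)(b))

Door frame (S23–S27): a classical Leray–Hopf solution `(u, p)` on `[0,T)` with viscosity `ν`, local Type I(`M`) on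
`Q_ρ(x₀, T)`: `‖u(t,x)‖ (‖x − x₀‖ + √(ν(T−t))) ≤ M`.  Pineau–Vicol frame: `ν = 1`, apex `(0,0)`, region `[−1,0) × B₁`.
The change of variables is `v(s,y) = (λ/ν) u(T + βs, x₀ + λy)`, `q(s,y) = (λ/ν)² (p − p(·,x₁))(T + βs, x₀ + λy)`, `β = λ²/ν`:
* `isClassicalNSSolutionOnRegion_pressure_sub_value`, `pvFrame_isClassical` — `(v, q)` is classical on `[−1,0) × B₁`
  (`IsClassicalNSSolutionOnRegion.stRescale_of_isOpen`; the pressure shifted by its value at `x₁` is still jointly smooth);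
* `pv_region_eq_preimage`, `lintegral_pv_pressure_le`, `lintegral_pv_gradient_eq` — transport of the pressure level
  `∫∫|q|^{3/2}` and of the dissipation `∫∫|∇v|²` (`setLIntegral_preimage_comp_stAffine`, product ≤ iterated integral);
* `curl_pv_slice`, `norm_curl_physWindowField` — `curl (α u(t, x₀ + λ·)) = αλ (curl u(t))(x₀ + λ·)`
  (`FlatSwirlGauge.curl_smul_comp_smul`, `curl_comp_add_const`), in particular
  `‖curl (physWindowField T x₀ u t) y‖ = (T − t)‖ω(t, x₀ + √(T−t) y)‖`;
* `pv_typeI_transfer` — (1.15) with any `C_u ≥ M/ν`; `isBackwardBoundedAt_of_pv_bound` — a bound on `B_ϱ × (−ϱ²,0)` in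
  the PV frame is `IsBackwardBoundedAt u T x₀` (`r₀ = ϱ min(λ, √β)`).
-/

noncomputable section

set_option linter.dupNamespace false

namespace Summit.NavierStokesRegularity.NavierStokesRegularity.Theorems.PeepholeVorticityDoor

open MeasureTheory Set Function Filter Topology TopologicalSpace Metric
open scoped NNReal ENNReal
open Literature.Analysis Literature.Analysis.FluidPDE
open Summit.NavierStokesRegularity.NavierStokesRegularity.Theorems.StableStrataDoorDefs (physWindowField)
open Summit.NavierStokesRegularity.NavierStokesRegularity.Theorems.StableStrataDoorClassSlabLevels
  (lintegral_slab_frobeniusNormSq_fderiv_le)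

-- nested operator types
set_option maxSynthPendingDepth 3

section Tools

variable {ν T : ℝ} {f u : ℝ → EuclideanSpace ℝ (Fin 3) → EuclideanSpace ℝ (Fin 3)}
  {p : ℝ → EuclideanSpace ℝ (Fin 3) → ℝ}

/-- Shifting the pressure by its value at a fixed point `x₁` keeps a classical solution on an open slab region (the
shift is a function of time: `∇` does not see it, and `p(·, x₁)` is jointly smooth). -/
theorem isClassicalNSSolutionOnRegion_pressure_sub_value {S : Set ℝ} (hS : IsOpen S)
    (h : IsClassicalNSSolutionOnRegion (S ×ˢ (univ : Set (EuclideanSpace ℝ (Fin 3)))) ν f u p)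
    (x₁ : EuclideanSpace ℝ (Fin 3)) :
    IsClassicalNSSolutionOnRegion (S ×ˢ (univ : Set (EuclideanSpace ℝ (Fin 3)))) ν f u
      (fun t x => p t x - p t x₁) := by
  have hO : IsOpen (S ×ˢ (univ : Set (EuclideanSpace ℝ (Fin 3)))) := hS.prod isOpen_univ
  obtain ⟨hu, hp, hmom, hdiv⟩ := (isClassicalNSSolutionOnRegion_iff_of_isOpen hO).1 h
  rw [isClassicalNSSolutionOnRegion_iff_of_isOpen hO]
  refine ⟨hu, ?_, fun t x htx => ?_, hdiv⟩
  · have h1 : uncurry (fun t x => p t x - p t x₁) = fun z : ℝ × EuclideanSpace ℝ (Fin 3) =>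
        uncurry p z - (uncurry p ∘ fun z : ℝ × EuclideanSpace ℝ (Fin 3) => (z.1, x₁)) z := by
      funext z; rfl
    rw [h1]
    refine hp.sub (hp.comp (contDiff_fst.prodMk contDiff_const).contDiffOn fun z hz => ?_)
    exact mk_mem_prod (mem_prod.1 hz).1 (mem_univ _)
  · have h2 : gradient (fun x => p t x - p t x₁) x = gradient (p t) x := by
      unfold gradient; rw [fderiv_sub_const]
    rw [h2]
    exact hmom t x htx

/-- **The rescaled pair is classical on the Pineau–Vicol region.**  For `0 < β < T`, `λ = √(νβ)`, the pair
`v = (λ/ν) u(T + β·, x₀ + λ·)`, `q = (λ/ν)² (p − p(·,x₁))(T + β·, x₀ + λ·)` is a classical solution with `ν = 1`, `f = 0` on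
`[−1, 0) × B₁` (indeed on `(−T/β, 0) × ℝ³`). -/
theorem pvFrame_isClassical (hν : 0 < ν) (hsol : IsClassicalNSSolutionOn (Ico 0 T) ν 0 u p)
    {β : ℝ} (hβ : 0 < β) (hβT : β < T) (x₀ x₁ : EuclideanSpace ℝ (Fin 3)) :
    IsClassicalNSSolutionOnRegion (Ico (-1 : ℝ) 0 ×ˢ ball (0 : EuclideanSpace ℝ (Fin 3)) 1) 1 0
      ((Real.sqrt (ν * β) / ν) • stPull β (Real.sqrt (ν * β)) T x₀ u)
      ((Real.sqrt (ν * β) / ν) ^ 2 • stPull β (Real.sqrt (ν * β)) T x₀ (fun t x => p t x - p t x₁)) := by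
  set lam := Real.sqrt (ν * β) with hlam_def
  have hlam : 0 < lam := Real.sqrt_pos.2 (by positivity)
  have hlam2 : lam ^ 2 = ν * β := Real.sq_sqrt (by positivity)
  have hα : 0 < lam / ν := by positivity
  have h0 : IsClassicalNSSolutionOn (Ioo 0 T) ν 0 u p := hsol.mono Ioo_subset_Ico_self (uniqueDiffOn_Ioo 0 T)
  have hO : IsOpen (Ioo 0 T ×ˢ (univ : Set (EuclideanSpace ℝ (Fin 3)))) := isOpen_Ioo.prod isOpen_univ
  have h2 := isClassicalNSSolutionOnRegion_pressure_sub_value isOpen_Ioo h0.onRegion x₁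
  have hβeq : β = lam / ν * lam := by
    field_simp
    nlinarith [hlam2]
  have h3 := h2.stRescale_of_isOpen hO hα hlam hβeq T x₀
  have hvisc : lam / ν * ν / lam = 1 := by
    field_simp
  have hforce : ((lam / ν) ^ 2 * lam) • stPull β lam T x₀ (0 : ℝ → EuclideanSpace ℝ (Fin 3) → EuclideanSpace ℝ (Fin 3)) = 0 := by
    funext s y
    simp [stPull_apply]
  rw [hvisc, hforce] at h3
  refine h3.mono ?_ ?_
  · intro z hz
    obtain ⟨hs, -⟩ := mem_prod.1 hz
    rw [mem_preimage]
    refine mk_mem_prod ⟨?_, ?_⟩ (mem_univ _)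
    · show 0 < T + β * z.1
      nlinarith [hs.1]
    · show T + β * z.1 < T
      nlinarith [hs.2]
  · intro t x htx
    rw [timeSection_prod _ htx.2]
    exact uniqueDiffOn_Ico (-1 : ℝ) 0 t htx.1

/-- the PV region is the preimage of the physical cylinder `(T−β, T) × B(x₀, λ)` under `Φ(s,y) = (T + βs, x₀ + λy)`. -/
theorem pv_region_eq_preimage {β lam : ℝ} (hβ : 0 < β) (hlam : 0 < lam) (T : ℝ) (x₀ : EuclideanSpace ℝ (Fin 3)) :
    Ioo (-1 : ℝ) 0 ×ˢ ball (0 : EuclideanSpace ℝ (Fin 3)) 1 =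
      stAffine β lam T x₀ ⁻¹' (Ioo (T - β) T ×ˢ ball x₀ lam) := by
  rw [stAffine_preimage_prod]
  congr 1
  · ext s
    simp only [mem_Ioo, mem_preimage]
    constructor
    · rintro ⟨h1, h2⟩; constructor <;> nlinarith
    · rintro ⟨h1, h2⟩; constructor <;> nlinarith
  · ext y
    simp only [mem_ball, mem_preimage, dist_eq_norm, add_sub_cancel_left, norm_smul, sub_zero,
      Real.norm_of_nonneg hlam.le]
    constructor
    · intro h
      exact mul_lt_of_lt_one_right hlam h
    · intro h
      by_contra h'
      have : lam * 1 ≤ lam * ‖y‖ := mul_le_mul_of_nonneg_left (not_lt.1 h') hlam.le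
      linarith

/-- **Transport of the pressure level**: `∫∫_{(−1,0)×B₁} |q|^{3/2} ≤ (βλ³)⁻¹ |α²|^{3/2} ∫_{T−β}^T ∫_{B(x₀,λ)} |p − p(·,x₁)|^{3/2}`
for `q = α² (p − p(·,x₁)) ∘ Φ` (change of variables, product integral ≤ iterated integral). -/
theorem lintegral_pv_pressure_le {β lam : ℝ} (hβ : 0 < β) (hlam : 0 < lam) (α T : ℝ)
    (x₀ x₁ : EuclideanSpace ℝ (Fin 3)) (p : ℝ → EuclideanSpace ℝ (Fin 3) → ℝ) :
    ∫⁻ w in Ioo (-1 : ℝ) 0 ×ˢ ball (0 : EuclideanSpace ℝ (Fin 3)) 1,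
        ‖(α ^ 2 • stPull β lam T x₀ (fun t x => p t x - p t x₁)) w.1 w.2‖ₑ ^ (3 / 2 : ℝ) ≤
      ENNReal.ofReal (β * lam ^ 3)⁻¹ * (‖α ^ 2‖ₑ ^ (3 / 2 : ℝ) *
        ∫⁻ t in Ioo (T - β) T, ∫⁻ x in ball x₀ lam, ‖p t x - p t x₁‖ₑ ^ (3 / 2 : ℝ)) := by
  set G : ℝ × EuclideanSpace ℝ (Fin 3) → ℝ≥0∞ := fun z =>
    ‖α ^ 2‖ₑ ^ (3 / 2 : ℝ) * ‖p z.1 z.2 - p z.1 x₁‖ₑ ^ (3 / 2 : ℝ) with hG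
  have hint : (fun w : ℝ × EuclideanSpace ℝ (Fin 3) =>
      ‖(α ^ 2 • stPull β lam T x₀ (fun t x => p t x - p t x₁)) w.1 w.2‖ₑ ^ (3 / 2 : ℝ)) =
      fun w => G (stAffine β lam T x₀ w) := by
    funext w
    simp only [hG, smul_stPull_apply, stAffine_fst, stAffine_snd, smul_eq_mul, enorm_mul,
      ENNReal.mul_rpow_of_nonneg _ _ (by norm_num : (0 : ℝ) ≤ 3 / 2)]
  have hα : ‖α ^ 2‖ₑ ^ (3 / 2 : ℝ) ≠ ⊤ := ENNReal.rpow_ne_top_of_nonneg (by norm_num) enorm_ne_top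
  rw [pv_region_eq_preimage hβ hlam T x₀, hint, setLIntegral_preimage_comp_stAffine hβ hlam,
    finrank_euclideanSpace_fin]
  gcongr
  rw [hG, lintegral_const_mul' _ _ hα]
  gcongr
  rw [Measure.volume_eq_prod, ← Measure.prod_restrict]
  exact lintegral_prod_le _

/-- **Transport of the dissipation level**: `∫∫_{(−1,0)×B₁} |∇v|² = (βλ³)⁻¹ (αλ)² ∫∫_{(T−β,T)×B(x₀,λ)} |∇u|²` for
`v = α u ∘ Φ` (chain rule `fderiv_stPull`, change of variables). -/
theorem lintegral_pv_gradient_eq {β lam : ℝ} (hβ : 0 < β) (hlam : 0 < lam) (α T : ℝ)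
    (x₀ : EuclideanSpace ℝ (Fin 3)) (u : ℝ → EuclideanSpace ℝ (Fin 3) → EuclideanSpace ℝ (Fin 3)) :
    ∫⁻ w in Ioo (-1 : ℝ) 0 ×ˢ ball (0 : EuclideanSpace ℝ (Fin 3)) 1,
        ENNReal.ofReal (frobeniusNormSq (fderiv ℝ ((α • stPull β lam T x₀ u) w.1) w.2)) =
      ENNReal.ofReal (β * lam ^ 3)⁻¹ * (ENNReal.ofReal ((α * lam) ^ 2) *
        ∫⁻ z in Ioo (T - β) T ×ˢ ball x₀ lam, ENNReal.ofReal (frobeniusNormSq (fderiv ℝ (u z.1) z.2))) := by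
  set H : ℝ × EuclideanSpace ℝ (Fin 3) → ℝ≥0∞ := fun z =>
    ENNReal.ofReal ((α * lam) ^ 2) * ENNReal.ofReal (frobeniusNormSq (fderiv ℝ (u z.1) z.2)) with hH
  have hint : (fun w : ℝ × EuclideanSpace ℝ (Fin 3) =>
      ENNReal.ofReal (frobeniusNormSq (fderiv ℝ ((α • stPull β lam T x₀ u) w.1) w.2))) =
      fun w => H (stAffine β lam T x₀ w) := by
    funext w
    have h1 : (α • stPull β lam T x₀ u) w.1 = α • stPull β lam T x₀ u w.1 := rfl
    rw [h1, fderiv_const_smul_field, Pi.smul_apply, fderiv_stPull, smul_smul, frobeniusNormSq_smul, hH]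
    simp only [stAffine_fst, stAffine_snd]
    rw [ENNReal.ofReal_mul (sq_nonneg _)]
  rw [pv_region_eq_preimage hβ hlam T x₀, hint, setLIntegral_preimage_comp_stAffine hβ hlam,
    finrank_euclideanSpace_fin, hH, lintegral_const_mul' _ _ ENNReal.ofReal_ne_top]

/-- **The curl of the rescaled slice**: `curl (α u(t, x₀ + λ·))(z) = (αλ) curl u(t)(x₀ + λz)`. -/
theorem curl_pv_slice (α lam t : ℝ) (x₀ z : EuclideanSpace ℝ (Fin 3))
    (u : ℝ → EuclideanSpace ℝ (Fin 3) → EuclideanSpace ℝ (Fin 3)) :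
    curl (fun y => α • u t (x₀ + lam • y)) z = (α * lam) • curl (u t) (x₀ + lam • z) := by
  obtain ⟨w, hw⟩ : ∃ w : EuclideanSpace ℝ (Fin 3) → EuclideanSpace ℝ (Fin 3), w = fun x => u t (x + x₀) := ⟨_, rfl⟩
  have h1 : (fun y => α • u t (x₀ + lam • y)) = fun y => α • w (lam • y) := by
    funext y
    rw [hw, add_comm]
  have h2 : curl w (lam • z) = curl (u t) (x₀ + lam • z) := by
    rw [hw, curl_comp_add_const, add_comm]
  rw [h1, curl_smul_comp_smul, h2]

/-- **The curl of the physical window field**: `‖curl (√(T−t) u(t, x₀ + √(T−t)·))(y)‖ = (T − t) ‖curl u(t)(x₀ + √(T−t) y)‖`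
for `t ≤ T`. -/
theorem norm_curl_physWindowField {T t : ℝ} (ht : t ≤ T) (x₀ y : EuclideanSpace ℝ (Fin 3))
    (u : ℝ → EuclideanSpace ℝ (Fin 3) → EuclideanSpace ℝ (Fin 3)) :
    ‖curl (physWindowField T x₀ u t) y‖ = (T - t) * ‖curl (u t) (x₀ + Real.sqrt (T - t) • y)‖ := by
  have h1 : physWindowField T x₀ u t = fun y => Real.sqrt (T - t) • u t (x₀ + Real.sqrt (T - t) • y) := rfl
  rw [h1, curl_pv_slice, norm_smul, Real.norm_of_nonneg (by positivity), ← pow_two, Real.sq_sqrt (by linarith)]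

end Tools


section Transfer

variable {ν T : ℝ} {u : ℝ → EuclideanSpace ℝ (Fin 3) → EuclideanSpace ℝ (Fin 3)} {x₀ : EuclideanSpace ℝ (Fin 3)}

/-- **(1.15) from local Type I**: under `‖u(t,x)‖ (‖x − x₀‖ + √(ν(T−t))) ≤ M` on `Q_ρ(x₀,T)` the rescaled field
`v = (λ/ν) u(T + β·, x₀ + λ·)`, `λ² = νβ`, `β < min(T, ρ²)`, `λ < ρ`, obeys `‖v(s,z)‖ ≤ C_u/(√(−s) + ‖z‖)` on `[−1,0) × B₁` for
every `C_u ≥ M/ν`. -/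
theorem pv_typeI_transfer {M ρ β lam Cu : ℝ} (hν : 0 < ν) (hβT : β < T) (hβρ : β < ρ ^ 2)
    (hlam : 0 < lam) (hlam2 : lam ^ 2 = ν * β) (hlamρ : lam < ρ) (hMCu : M / ν ≤ Cu)
    (hM : ∀ t ∈ Ico 0 T, T - ρ ^ 2 < t → ∀ x ∈ ball x₀ ρ, ‖u t x‖ * (‖x - x₀‖ + Real.sqrt (ν * (T - t))) ≤ M) :
    ∀ s ∈ Ico (-1 : ℝ) 0, ∀ z ∈ ball (0 : EuclideanSpace ℝ (Fin 3)) 1,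
      ‖((lam / ν) • stPull β lam T x₀ u) s z‖ ≤ Cu / (Real.sqrt (-s) + ‖z‖) := by
  intro s hs z hz
  rw [mem_ball_zero_iff] at hz
  have hβ : 0 < β := by
    have : 0 < lam ^ 2 := by positivity
    rw [hlam2] at this
    exact pos_of_mul_pos_right this hν.le
  have hα : 0 < lam / ν := by positivity
  have hs0 : 0 < -s := by linarith [hs.2]
  have hsq : 0 < Real.sqrt (-s) := Real.sqrt_pos.2 hs0
  have ht1 : T + β * s ∈ Ico 0 T := ⟨by nlinarith [hs.1], by nlinarith [hs.2]⟩
  have ht2 : T - ρ ^ 2 < T + β * s := by nlinarith [hs.1]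
  have hx : x₀ + lam • z ∈ ball x₀ ρ := by
    rw [mem_ball, dist_eq_norm, add_sub_cancel_left, norm_smul, Real.norm_of_nonneg hlam.le]
    nlinarith [norm_nonneg z]
  have key := hM (T + β * s) ht1 ht2 (x₀ + lam • z) hx
  have hxx : ‖x₀ + lam • z - x₀‖ = lam * ‖z‖ := by
    rw [add_sub_cancel_left, norm_smul, Real.norm_of_nonneg hlam.le]
  have htt : Real.sqrt (ν * (T - (T + β * s))) = lam * Real.sqrt (-s) := by
    have : ν * (T - (T + β * s)) = lam ^ 2 * (-s) := by rw [hlam2]; ring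
    rw [this, Real.sqrt_mul' _ hs0.le, Real.sqrt_sq hlam.le]
  rw [hxx, htt, ← mul_add] at key
  rw [smul_stPull_apply, norm_smul, Real.norm_of_nonneg hα.le, le_div_iff₀ (by positivity)]
  calc lam / ν * ‖u (T + β * s) (x₀ + lam • z)‖ * (Real.sqrt (-s) + ‖z‖)
      = (‖u (T + β * s) (x₀ + lam • z)‖ * (lam * (‖z‖ + Real.sqrt (-s)))) / ν := by ring
    _ ≤ M / ν := by gcongr
    _ ≤ Cu := hMCu

/-- **Pull-back of the conclusion**: a bound for `v = (λ/ν) u(T + β·, x₀ + λ·)` on `B_ϱ × (−ϱ², 0)` is a bound for `u` on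
`Q_{r₀}(x₀, T)`, `r₀ = ϱ min(λ, √β)`, i.e. `IsBackwardBoundedAt u T x₀`. -/
theorem isBackwardBoundedAt_of_pv_bound {β lam ϱ B : ℝ} (hν : 0 < ν) (hβ : 0 < β) (hlam : 0 < lam) (hϱ : 0 < ϱ)
    (hB : ∀ s : ℝ, -ϱ ^ 2 < s → s < 0 → ∀ z ∈ ball (0 : EuclideanSpace ℝ (Fin 3)) ϱ,
      ‖((lam / ν) • stPull β lam T x₀ u) s z‖ ≤ B) :
    IsBackwardBoundedAt u T x₀ := by
  have hα : 0 < lam / ν := by positivity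
  have hsβ : 0 < Real.sqrt β := Real.sqrt_pos.2 hβ
  set r₀ : ℝ := ϱ * min lam (Real.sqrt β) with hr₀_def
  have hmin : 0 < min lam (Real.sqrt β) := lt_min hlam hsβ
  have hr₀ : 0 < r₀ := mul_pos hϱ hmin
  refine ⟨r₀, hr₀, B * (ν / lam), fun t ht x hx => ?_⟩
  set s : ℝ := (t - T) / β with hs_def
  set z : EuclideanSpace ℝ (Fin 3) := lam⁻¹ • (x - x₀) with hz_def
  have hs0 : s < 0 := div_neg_of_neg_of_pos (by linarith [ht.2]) hβ
  have hs1 : -ϱ ^ 2 < s := by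
    have h1 : r₀ ≤ ϱ * Real.sqrt β := by
      rw [hr₀_def]
      gcongr
      exact min_le_right _ _
    have h2 : r₀ ^ 2 ≤ ϱ ^ 2 * β := by
      calc r₀ ^ 2 ≤ (ϱ * Real.sqrt β) ^ 2 := pow_le_pow_left₀ hr₀.le h1 2
        _ = ϱ ^ 2 * β := by rw [mul_pow, Real.sq_sqrt hβ.le]
    rw [hs_def, lt_div_iff₀ hβ]
    nlinarith [ht.1]
  have hz1 : z ∈ ball (0 : EuclideanSpace ℝ (Fin 3)) ϱ := by
    rw [mem_ball_zero_iff, hz_def, norm_smul, Real.norm_of_nonneg (inv_nonneg.2 hlam.le),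
      inv_mul_lt_iff₀ hlam]
    rw [mem_ball, dist_eq_norm] at hx
    have h1 : r₀ ≤ ϱ * lam := by
      rw [hr₀_def]
      gcongr
      exact min_le_left _ _
    linarith
  have key := hB s hs1 hs0 z hz1
  have e1 : T + β * s = t := by
    rw [hs_def, mul_div_cancel₀ _ hβ.ne']
    ring
  have e2 : x₀ + lam • z = x := by
    rw [hz_def, smul_smul, mul_inv_cancel₀ hlam.ne', one_smul, add_sub_cancel]
  rw [smul_stPull_apply, e1, e2, norm_smul, Real.norm_of_nonneg hα.le] at key
  calc ‖u t x‖ = (lam / ν * ‖u t x‖) * (ν / lam) := by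
        field_simp
    _ ≤ B * (ν / lam) := by gcongr

end Transfer

end Summit.NavierStokesRegularity.NavierStokesRegularity.Theorems.PeepholeVorticityDoor

end
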